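import Summits.QuantumAdvantage.AdviceFreeQNC0.ColumnTest
import HarnessLib

/-!
# Cell qa-qnc0 (rung F-Q1, density axis): LEMMA G′ — the explicit two-level (★)-certificate from
# outside-heaviness (planner qa-qnc0-p1 gen 14, Sketch14 §OutHeavy, ask P19), CORE STEP

Statements VERBATIM from Sketch14 §OutHeavy: `OutHeavyButOne`, `OutHeavyEight`, `OutHeavySeven`,
`StarOfOutHeavyButOne`, `OneWordMIEight`, `OneWordMIEightChain` (+ `oneWordMIEightChain`, proof verbatim).

FINDING (qn-prover g8, STATUS 14:3xZ): `StarOfOutHeavyButOne m` as typed quantifies over ALL patterns `K0`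
and is refutable ((★) forces `inCount K0 c ≤ outCount K0 c` — take `s ≡ 0`, tests `X = 0`, `X = c` — which
`OutHeavyButOne` does not give; at `m = 8` a 30-subset `Z` of a minimum word's support is a witness).  The
m = 8 chain only needs it at OPTIMAL `K0`, where SC₁ holds; so this file proves the REPAIRED core:

* `OutHeavyCore.core` — in the frame where the zero codeword minimises the outside mismatch with `s`
  (`∀ Y ∈ C_m, #{u ∉ Z : s u} ≤ #{u ∉ Z : Y u ≠ s u}`), SC₁ at `c` plus `OutHeavyButOne m K0 c` give a
  fractional inside word `q ∈ [0,1]^Z` passing the column test against `s`: `q ≡ 1/2` if `2e ≥ w`, else the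
  TWO-LEVEL word (`α` on `supp c ∩ Z`, `β` off it, `t₁α + (w−t₁)β = e`, `0 ≤ α, β ≤ 1/2`,
  `2t₁α ≥ t₁ − t₂ + 2i`) of ROUND-13 §1.

The translation by the minimiser and the assembly `starCert_of_outHeavyButOne :
SC1At m K0 → OutHeavyButOne m K0 c → StarCert m K0`, `oneWordMIEight_of_outHeavyEight` are in
`OutHeavyStarMain.lean`.  WHAT THIS IS NOT: `OutHeavyEight` (finite) is not proved; separation NOT moved.
-/

noncomputable section

namespace Summit.QuantumAdvantage.AdviceFreeQNC0

open Finset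
open Literature.Computability.MetaComplexity Literature.Computability.MetaComplexity.Smolensky

namespace MassInequality

/-! ### Sketch14 §OutHeavy — statements VERBATIM -/
section OutHeavy

/-- OUTSIDE-HEAVINESS WITH ONE NAMED EXCEPTION.  (Sketch14, verbatim.) -/
def OutHeavyButOne (m : ℕ) (K0 c : (Fin m → Bool) → Bool) : Prop :=
  IsElim1 m c ∧ ∀ Y, IsElim1 m Y → pwt Y ≠ 0 → Y ≠ c → failCount K0 ≤ outCount K0 Y

/-- Finite fact at m = 8.  (Sketch14, verbatim; not proved here.) -/
def OutHeavyEight : Prop :=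
  ∀ K0 : (Fin 8 → Bool) → Bool, IsOpt1 8 K0 → IsSymPat K0 → ∃ c, IsMinWord 8 c ∧ OutHeavyButOne 8 K0 c

/-- Finite fact at m = 7.  (Sketch14, verbatim; not proved here.) -/
def OutHeavySeven : Prop :=
  ∀ K0 : (Fin 7 → Bool) → Bool, IsOpt1 7 K0 → IsSymPat K0 → OutHeavyButOne 7 K0 (fun _ => false)

/-- **LEMMA G′** as typed by the planner (Sketch14, verbatim).  NOTE: over ALL `K0` this is refutable (see the
module docstring); the repaired form with `SC1At m K0` is `starCert_of_outHeavyButOne`. -/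
def StarOfOutHeavyButOne (m : ℕ) : Prop :=
  ∀ K0 c : (Fin m → Bool) → Bool, OutHeavyButOne m K0 c → StarCert m K0

/-- **ONE-WORD MI at m = 8**.  (Sketch14, verbatim.) -/
def OneWordMIEight : Prop := ∀ K0 : (Fin 8 → Bool) → Bool, IsOpt1 8 K0 → IsSymPat K0 → OneWordMIAt 8 K0

/-- The assembly of `OneWordMIEight` from the four lemmas.  (Sketch14, verbatim.) -/
def OneWordMIEightChain : Prop :=
  OutHeavyEight → StarOfOutHeavyButOne 8 → RelMIOfStar 8 → OneWordOfRelMI 8 → OneWordDecode 8 → OneWordMIEight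

/-- (Sketch14, proof verbatim.) -/
theorem oneWordMIEightChain : OneWordMIEightChain := by
  intro hO hS hR hW hD K0 hK hsym
  obtain ⟨c, _, hc⟩ := hO K0 hK hsym
  exact hW K0 hD (hR K0 (hS K0 c hc))

end OutHeavy

end MassInequality

open MassInequality ColTestProofs

namespace OutHeavyCore

variable {m : ℕ} (K0 c s : (Fin m → Bool) → Bool)

/-- Outside mismatch count of `Y` against `s` (the right-hand side of the column test). -/
def mis (Y : (Fin m → Bool) → Bool) : ℕ := (univ.filter fun u : Fin m → Bool => K0 u = true ∧ Y u ≠ s u).card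

/-- `e = #{u ∉ Z : s u}`. -/
def eOut : ℕ := (univ.filter fun u : Fin m → Bool => K0 u = true ∧ s u = true).card

/-- `i = #{u ∉ Z : c u ∧ s u}`. -/
def iOut : ℕ := (univ.filter fun u : Fin m → Bool => K0 u = true ∧ (c u = true ∧ s u = true)).card

/-- `t₁ = |supp c ∩ Z|`. -/
def tIn : ℕ := (univ.filter fun u : Fin m → Bool => K0 u = false ∧ c u = true).card

variable {K0 c s}

/-- `mis 0 = e`. -/
theorem mis_zero : mis K0 s (fun _ => false) = eOut K0 s := by
  unfold mis eOut; congr 1; ext u; simp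

/-- `mis c + 2 i = t₂ + e` (inclusion–exclusion on the outside). -/
theorem mis_c_add : mis K0 s c + 2 * iOut K0 c s = MassInequality.outCount K0 c + eOut K0 s := by
  unfold mis iOut MassInequality.outCount eOut
  simp only [Finset.card_filter, ← Finset.sum_add_distrib, Finset.mul_sum]
  refine Finset.sum_congr rfl fun u _ => ?_
  cases K0 u <;> cases c u <;> cases s u <;> simp

/-- `outCount Y ≤ mis Y + e`. -/
theorem outCount_le_mis_add (Y : (Fin m → Bool) → Bool) : MassInequality.outCount K0 Y ≤ mis K0 s Y + eOut K0 s := by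
  unfold MassInequality.outCount mis eOut
  refine (card_le_card fun u hu => ?_).trans (card_union_le _ _)
  simp only [mem_filter, mem_univ, true_and, mem_union] at hu ⊢
  cases hs : s u
  · left; exact ⟨hu.2, by rw [hu.1]; decide⟩
  · right; exact ⟨hu.2, rfl⟩

/-- `i ≤ e`. -/
theorem iOut_le_eOut : iOut K0 c s ≤ eOut K0 s := by
  unfold iOut eOut; exact card_le_card (fun u hu => by simp only [mem_filter, mem_univ, true_and] at hu ⊢; exact ⟨hu.1, hu.2.2⟩)

/-- `t₁ = MassInequality.inCount K0 c`. -/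
theorem tIn_eq_inCount : tIn K0 c = MassInequality.inCount K0 c := by
  unfold tIn inCount; congr 1; ext u; simp only [mem_filter, mem_univ, true_and]; exact and_comm

/-- `t₁ ≤ w = failCount K0`. -/
theorem tIn_le_failCount : tIn K0 c ≤ failCount K0 := by
  unfold tIn failCount; exact card_le_card (fun u hu => by simp only [mem_filter, mem_univ, true_and] at hu ⊢; exact hu.1)

/-- `|bq b − α| = α + bq b · (1 − 2α)` for `α ∈ [0,1]`. -/
theorem abs_bq_sub_eq (b : Bool) {α : ℚ} (h0 : 0 ≤ α) (h1 : α ≤ 1) : |bq b - α| = α + bq b * (1 - 2 * α) := by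
  rw [abs_bq_sub b h0 h1]; ring

/-- `Σ bq = card` on a finset. -/
theorem sum_bq_eq_card (S : Finset (Fin m → Bool)) (Y : (Fin m → Bool) → Bool) :
    ∑ z ∈ S, bq (Y z) = ((S.filter fun z => Y z = true).card : ℚ) := by
  rw [Finset.card_filter, Nat.cast_sum]
  refine sum_congr rfl fun z _ => ?_
  cases Y z <;> simp [bq]

/-- **The two-level sum**: with `q z = α` on `supp c` and `β` off it,
`Σ_{z ∈ Z} |bq (Y z) − q z| = t₁α + (w − t₁)β + (1 − 2α)·a₁ + (1 − 2β)·a₂`,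
`a₁ = |Y ∩ supp c ∩ Z|`, `a₂ = |Y ∩ Z ∖ supp c|`. -/
theorem sum_two_level (Y : (Fin m → Bool) → Bool) {α β : ℚ} (hα0 : 0 ≤ α) (hα1 : α ≤ 1) (hβ0 : 0 ≤ β) (hβ1 : β ≤ 1) :
    (∑ z ∈ univ.filter (fun z : Fin m → Bool => K0 z = false), |bq (Y z) - (if c z = true then α else β)|) =
      (tIn K0 c : ℚ) * α + ((failCount K0 : ℚ) - tIn K0 c) * β +
        (1 - 2 * α) * ((univ.filter fun z : Fin m → Bool => K0 z = false ∧ (c z = true ∧ Y z = true)).card : ℚ) +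
        (1 - 2 * β) * ((univ.filter fun z : Fin m → Bool => K0 z = false ∧ (c z = false ∧ Y z = true)).card : ℚ) := by
  classical
  set Zs := univ.filter (fun z : Fin m → Bool => K0 z = false) with hZs
  -- pointwise form of the summand
  have hpt : ∀ z, |bq (Y z) - (if c z = true then α else β)| =
      (if c z = true then α else β) + bq (Y z) * (1 - 2 * (if c z = true then α else β)) := by
    intro z
    by_cases hcz : c z = true
    · rw [if_pos hcz]; exact abs_bq_sub_eq _ hα0 hα1
    · rw [if_neg hcz]; exact abs_bq_sub_eq _ hβ0 hβ1
  rw [sum_congr rfl fun z _ => hpt z, sum_add_distrib]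
  -- the two pieces, split by `c`
  have hsplit : ∀ g : (Fin m → Bool) → ℚ, ∑ z ∈ Zs, g z =
      ∑ z ∈ Zs.filter (fun z => c z = true), g z + ∑ z ∈ Zs.filter (fun z => ¬ c z = true), g z :=
    fun g => (sum_filter_add_sum_filter_not Zs (fun z => c z = true) g).symm
  have hP : Zs.filter (fun z => c z = true) = univ.filter fun z : Fin m → Bool => K0 z = false ∧ c z = true := by
    rw [hZs, filter_filter]
  have hQ : Zs.filter (fun z => ¬ c z = true) = univ.filter fun z : Fin m → Bool => K0 z = false ∧ c z = false := by
    rw [hZs, filter_filter]; congr 1; ext z; simp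
  have hw : ((univ.filter fun z : Fin m → Bool => K0 z = false ∧ c z = false).card : ℚ) =
      (failCount K0 : ℚ) - tIn K0 c := by
    have h : tIn K0 c + (univ.filter fun z : Fin m → Bool => K0 z = false ∧ c z = false).card = failCount K0 := by
      unfold tIn failCount
      rw [← hZs, ← hP, ← hQ, Finset.card_filter_add_card_filter_not]
    have h' : ((tIn K0 c : ℕ) : ℚ) + ((univ.filter fun z : Fin m → Bool => K0 z = false ∧ c z = false).card : ℚ) =
        failCount K0 := by exact_mod_cast h
    linarith
  have hPa : ∑ z ∈ Zs.filter (fun z => c z = true), (if c z = true then α else β) = (tIn K0 c : ℚ) * α := by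
    rw [sum_congr rfl fun z hz => if_pos (mem_filter.1 hz).2, sum_const, nsmul_eq_mul, hP]; rfl
  have hQb : ∑ z ∈ Zs.filter (fun z => ¬ c z = true), (if c z = true then α else β) =
      ((failCount K0 : ℚ) - tIn K0 c) * β := by
    rw [sum_congr rfl fun z hz => if_neg (mem_filter.1 hz).2, sum_const, nsmul_eq_mul, hQ, hw]
  have hPc : ∑ z ∈ Zs.filter (fun z => c z = true), bq (Y z) * (1 - 2 * (if c z = true then α else β)) =
      (1 - 2 * α) * ((univ.filter fun z : Fin m → Bool => K0 z = false ∧ (c z = true ∧ Y z = true)).card : ℚ) := by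
    rw [sum_congr rfl fun z hz => by rw [if_pos (mem_filter.1 hz).2], ← sum_mul, sum_bq_eq_card, hP,
      filter_filter, mul_comm]
    congr 3; ext z; simp only [mem_filter, mem_univ, true_and, and_assoc]
  have hQc : ∑ z ∈ Zs.filter (fun z => ¬ c z = true), bq (Y z) * (1 - 2 * (if c z = true then α else β)) =
      (1 - 2 * β) * ((univ.filter fun z : Fin m → Bool => K0 z = false ∧ (c z = false ∧ Y z = true)).card : ℚ) := by
    rw [sum_congr rfl fun z hz => by rw [if_neg (mem_filter.1 hz).2], ← sum_mul, sum_bq_eq_card, hQ,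
      filter_filter, mul_comm]
    congr 3; ext z; simp only [mem_filter, mem_univ, true_and, and_assoc]
  rw [hsplit (fun z => if c z = true then α else β), hsplit (fun z => bq (Y z) * (1 - 2 * (if c z = true then α else β))),
    hPa, hQb, hPc, hQc]
  ring

end OutHeavyCore

end Summit.QuantumAdvantage.AdviceFreeQNC0
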